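import Summits.CriticalPhenomena.PercolationContinuityZ3.Theorems.PercNearOneGluingNoHeavyLowerTailGeometricMomentCIL
import HarnessLib

/-!
# `NoHeavyLowerTail` (stmt-CriticalPhenomena-4575) — geometric-moment CIL with a RELIABILITY-DEPENDENT constant
# `C(τ) = o(τ^{-1/2})` still closes the crux

Typed reduction (hull-port / coupling seat `prim-hp-1`, gen 4; `--supports stmt-CriticalPhenomena-4575`).  No definitions,
no named facts, no sorries.  Notation of `…GeometricMomentCIL` (lead, gen 4): `μ = prodBernoulli w` on `Fin n`, relays `A`
(`k = |A|`), observer `o ∉ A`, `π(x) = {a ∈ A : x ↔ a}`, `N = |π(o)|`, and for `v ∈ (0,1]`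

  `L(v) = Σ_{j=1}^{k} v^j μ{N = j}`,   `R_a(v) = Σ_{j=0}^{k} v^j μ{|π(a)| = j}`.

`Theorems.noHeavyLowerTail_of_geometricMomentCIL` asks for GM-CIL(C) — `∃ a, L(v) ≤ C·R_a(v)` — on ALL graphs with ONE
constant `C`.  This file records that the constant may GROW as the reliability parameter tends to zero:

* `noHeavyLowerTail_of_geometricMomentCIL_modulus` — if for every `η > 0` there are `τ > 0` and `C ≥ 0` with
  `C·√τ ≤ η` such that GM-CIL(C) holds on every graph whose relays are pairwise `(1−τ)`-reliable
  (`μ(a ↮ a') ≤ τ` for `a ≠ a'`), then `NoHeavyLowerTail`.  Equivalently: GM-CIL with any constant `C(τ) = o(τ^{-1/2})`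
  on `τ`-reliable instances suffices — e.g. `C(τ) = C₀·log(1/τ)` or `C₀·τ^{-1/3}`.

Proof: the lead's argument verbatim with the constants re-ordered — `J = ⌊k/4⌋`, `v = s^{1/J}`,
`s·μ(1 ≤ N ≤ J) ≤ L(v) ≤ C·R_a(v) ≤ C(2τ + s²)` (`GeomMomentCIL.pow_mul_window_le_momentSum`,
`GeomMomentCIL.momentSum_le_small_add_pow`, pair counting `Theorems.smallBlock_le_two_mul`), now with `s = 2√τ`
(after shrinking `τ` below `1/4` and `ε/2`, which keeps both the reliability class and `C√τ ≤ η`):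
`μ(1 ≤ N ≤ k/4) ≤ 6Cτ/s = 3C√τ ≤ 3η`; then `Theorems.noHeavyLowerTail_of_oneCut_modulus` at `ρ = 1/4`.

WHY IT MATTERS (seat memo HULLPORT-COUPLING.md §37, §39): every known k-uniform argument for the lower tail pays one unit per
dyadic pocket scale (finger line `16·L·δ`, the designation-scheme / Kozma–Nitzan-Lemma-2 packing `L(v(1−ε)) ≤ log(1/ε)·max R(v)`),
i.e. a constant `≍ log k`; this file says that a constant `≍ log(1/τ)` — "only `O(log 1/τ)` scales carry mass" — or even
`τ^{-1/2+δ}` would already close the crux, so the open k-uniform step is a bound on the NUMBER OF HEAVY POCKET SCALES in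
terms of the reliability alone.
-/

noncomputable section

namespace Summit.CriticalPhenomena.PercolationContinuityZ3.Theorems

open MeasureTheory Set Literature.Probability.LatticeModels Literature.Probability.Percolation
open Summit.CriticalPhenomena.PercolationContinuityZ3.Theses.PercNearOneGluing
open scoped Classical BigOperators

open GeomMomentCIL in
/-- **Geometric-moment CIL with a reliability-dependent constant `C(τ) = o(τ^{-1/2})` ⇒ `NoHeavyLowerTail`.**
If for every `η > 0` there exist `τ > 0` and `C ≥ 0` with `C · √τ ≤ η` such that every finite weighted graph
whose relays are pairwise `(1 − τ)`-reliable, every nonempty `A`, every `o ∉ A` and every `v ∈ (0,1]` admit a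
relay `a ∈ A` with `Σ_{j=1}^{|A|} v^j P(N = j) ≤ C · Σ_{j=0}^{|A|} v^j P(|π(a)| = j)`, then the crux holds. [this work] -/
theorem noHeavyLowerTail_of_geometricMomentCIL_modulus
    (hGM : ∀ η : ℝ, 0 < η → ∃ (τ C : ℝ), 0 < τ ∧ 0 ≤ C ∧ C * Real.sqrt τ ≤ η ∧
      ∀ (n : ℕ) (w : Sym2 (Fin n) → unitInterval) (A : Finset (Fin n)) (o : Fin n) (v : ℝ),
        (∀ a ∈ A, ∀ a' ∈ A, a ≠ a' →
          (prodBernoulli w).real (openConn a a' : Set (BondConfig (Fin n)))ᶜ ≤ τ) →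
        0 < v → v ≤ 1 → A.Nonempty → o ∉ A → ∃ a ∈ A,
          ∑ j ∈ Finset.Icc 1 A.card, v ^ j * (prodBernoulli w).real {ω : BondConfig (Fin n) |
              (A.filter fun x => ω ∈ openConn o x).card = j} ≤
            C * ∑ j ∈ Finset.range (A.card + 1), v ^ j * (prodBernoulli w).real {ω : BondConfig (Fin n) |
              (A.filter fun x => ω ∈ openConn a x).card = j}) :
    Summit.CriticalPhenomena.PercolationContinuityZ3.Theses.PercNearOneGluing.NoHeavyLowerTail := by
  refine noHeavyLowerTail_of_oneCut_modulus fun ε hε => ?_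
  obtain ⟨τ₀, C, hτ₀, hC, hCτ₀, hGM₀⟩ := hGM (ε / 8) (by linarith)
  -- shrink the reliability parameter: `τ = min τ₀ (min (1/4) (ε/2))`
  set τ : ℝ := min τ₀ (min (1 / 4) (ε / 2)) with hτdef
  have hττ₀ : τ ≤ τ₀ := min_le_left _ _
  have hτ4 : τ ≤ 1 / 4 := (min_le_right _ _).trans (min_le_left _ _)
  have hτε : τ ≤ ε / 2 := (min_le_right _ _).trans (min_le_right _ _)
  have hτ0 : 0 < τ := lt_min hτ₀ (lt_min (by norm_num) (by linarith))
  have hCτ : C * Real.sqrt τ ≤ ε / 8 :=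
    (mul_le_mul_of_nonneg_left (Real.sqrt_le_sqrt hττ₀) hC).trans hCτ₀
  -- the window height `s = 2√τ ∈ (0, 1]`
  set s : ℝ := 2 * Real.sqrt τ with hsdef
  have hsq0 : 0 < Real.sqrt τ := Real.sqrt_pos.2 hτ0
  have hs0 : 0 < s := by rw [hsdef]; linarith
  have hs1 : s ≤ 1 := by
    have h14 : Real.sqrt τ ≤ Real.sqrt (1 / 4) := Real.sqrt_le_sqrt hτ4
    have hq : Real.sqrt (1 / 4 : ℝ) = 1 / 2 := by
      rw [show (1 / 4 : ℝ) = (1 / 2) * (1 / 2) by norm_num]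
      exact Real.sqrt_mul_self (by norm_num)
    rw [hsdef]; linarith [hq ▸ h14]
  have hss : s * s = 4 * τ := by
    rw [hsdef]; nlinarith [Real.mul_self_sqrt hτ0.le]
  refine ⟨1 / 4, τ, by norm_num, hτ0, fun n w A o hpair hU => ?_⟩
  set μ := prodBernoulli w with hμ
  -- pairwise hypothesis including the diagonal
  have hpair' : ∀ a ∈ A, ∀ a' ∈ A, μ.real (openConn a a' : Set (BondConfig (Fin n)))ᶜ ≤ τ := by
    intro a ha a' ha'
    by_cases h : a = a'
    · subst h; exact measureReal_compl_openConn_self_le w a hτ0.le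
    · exact hpair a ha a' ha' h
  -- `E N ≤ k`
  have hEN : ∑ a ∈ A, μ.real (openConn o a : Set (BondConfig (Fin n))) ≤ A.card := by
    calc ∑ a ∈ A, μ.real (openConn o a : Set (BondConfig (Fin n))) ≤ ∑ a ∈ A, (1 : ℝ) :=
          Finset.sum_le_sum fun a _ => measureReal_le_one
      _ = A.card := by simp
  -- the crux window at `ρ = 1/4` lies inside the integer window `1 ≤ N ≤ ⌊k/4⌋`
  set J : ℕ := A.card / 4 with hJdef
  set T : Set (BondConfig (Fin n)) := {ω : BondConfig (Fin n) |
      1 ≤ (A.filter fun x => ω ∈ openConn o x).card ∧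
        (A.filter fun x => ω ∈ openConn o x).card ≤ J} with hTdef
  have hsub : {ω : BondConfig (Fin n) | 1 ≤ (A.filter fun a => ω ∈ openConn o a).card ∧
        ((A.filter fun a => ω ∈ openConn o a).card : ℝ) <
          1 / 4 * (∑ a ∈ A, μ.real (openConn o a : Set (BondConfig (Fin n))))} ⊆ T := by
    intro ω hω
    simp only [Set.mem_setOf_eq] at hω
    refine ⟨hω.1, ?_⟩
    have hlt : ((A.filter fun a => ω ∈ openConn o a).card : ℝ) < 1 / 4 * (A.card : ℝ) :=
      lt_of_lt_of_le hω.2 (by nlinarith)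
    have h4 : (4 * (A.filter fun a => ω ∈ openConn o a).card : ℕ) < A.card := by
      have : (4 : ℝ) * ((A.filter fun a => ω ∈ openConn o a).card : ℝ) < (A.card : ℝ) := by linarith
      exact_mod_cast this
    rw [hJdef]; omega
  refine (measureReal_mono hsub (measure_ne_top _ _)).trans ?_
  -- Case 1: `J = 0` (i.e. `k ≤ 3`): the window is empty.
  by_cases hJ0 : J = 0
  · have hT : T = ∅ := by
      ext ω; simp only [hTdef, Set.mem_setOf_eq, Set.mem_empty_iff_false, iff_false, not_and, not_le]
      intro h1; omega
    rw [hT, measureReal_empty]; exact hε.le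
  have hJ1 : 1 ≤ J := Nat.one_le_iff_ne_zero.2 hJ0
  have hAcard : 4 ≤ A.card := by rw [hJdef] at hJ1; omega
  have hAne : A.Nonempty := Finset.card_pos.1 (by omega)
  -- Case 2: `o ∈ A`: then `N = |π(o)|` and pair counting at the relay `o` suffices.
  by_cases ho : o ∈ A
  · have hT2 : T ⊆ {ω : BondConfig (Fin n) | 2 * (A.filter fun a' => ω ∈ openConn o a').card ≤ A.card} := by
      intro ω hω
      simp only [hTdef, Set.mem_setOf_eq] at hω ⊢
      rw [hJdef] at hω; omega
    calc μ.real T ≤ μ.real {ω : BondConfig (Fin n) |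
          2 * (A.filter fun a' => ω ∈ openConn o a').card ≤ A.card} :=
          measureReal_mono hT2 (measure_ne_top _ _)
      _ ≤ 2 * τ := smallBlock_le_two_mul w A o τ ho (hpair' o ho)
      _ ≤ ε := by linarith
  -- Case 3: `o ∉ A`, `k ≥ 4`: the geometric-moment argument with `v = s^{1/J}` on the `τ`-reliable instance.
  set v : ℝ := s ^ ((J : ℝ)⁻¹) with hvdef
  have hv0 : 0 < v := Real.rpow_pos_of_pos hs0 _
  have hv1 : v ≤ 1 := Real.rpow_le_one hs0.le hs1 (inv_nonneg.2 (Nat.cast_nonneg J))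
  have hvJ : v ^ J = s := Real.rpow_inv_natCast_pow hs0.le hJ0
  have hpairτ₀ : ∀ a ∈ A, ∀ a' ∈ A, a ≠ a' →
      μ.real (openConn a a' : Set (BondConfig (Fin n)))ᶜ ≤ τ₀ :=
    fun a ha a' ha' hne => (hpair a ha a' ha' hne).trans hττ₀
  obtain ⟨a, ha, hle⟩ := hGM₀ n w A o v hpairτ₀ hv0 hv1 hAne ho
  -- lower truncation of the left side
  have hlow := pow_mul_window_le_momentSum μ (fun ω => (A.filter fun x => ω ∈ openConn o x).card)
    v hv0.le hv1 J A.card (Nat.div_le_self _ _)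
  -- upper truncation of the right side at `h = ⌊k/2⌋ + 1`
  set h : ℕ := A.card / 2 + 1 with hhdef
  have hup := momentSum_le_small_add_pow μ (fun ω => (A.filter fun x => ω ∈ openConn a x).card)
    v hv0.le hv1 A.card h
  have hsmall : μ.real {ω : BondConfig (Fin n) | (A.filter fun x => ω ∈ openConn a x).card < h} ≤ 2 * τ := by
    have heq : {ω : BondConfig (Fin n) | (A.filter fun x => ω ∈ openConn a x).card < h} =
        {ω : BondConfig (Fin n) | 2 * (A.filter fun a' => ω ∈ openConn a a').card ≤ A.card} := by
      ext ω; simp only [Set.mem_setOf_eq, hhdef]; omega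
    rw [heq]
    exact smallBlock_le_two_mul w A a τ ha (hpair' a ha)
  have hvh : v ^ h ≤ s * s := by
    have h2J : 2 * J ≤ h := by rw [hhdef, hJdef]; omega
    calc v ^ h ≤ v ^ (2 * J) := pow_le_pow_of_le_one hv0.le hv1 h2J
      _ = s * s := by rw [pow_mul', hvJ, sq]
  -- assemble: `s · μ T ≤ C (2τ + s²) = 6 C τ = 3 C √τ · s ≤ (3ε/8) · s`
  have hchain : s * μ.real T ≤ C * (2 * τ + s * s) := by
    have e1 : v ^ J * μ.real T ≤ C * (μ.real {ω : BondConfig (Fin n) |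
        (A.filter fun x => ω ∈ openConn a x).card < h} + v ^ h) :=
      (hlow.trans hle).trans (mul_le_mul_of_nonneg_left hup hC)
    rw [hvJ] at e1
    refine e1.trans (mul_le_mul_of_nonneg_left (add_le_add hsmall hvh) hC)
  have hkey : C * (2 * τ + s * s) ≤ s * (3 * ε / 8) := by
    have hτsq : τ = Real.sqrt τ * Real.sqrt τ := (Real.mul_self_sqrt hτ0.le).symm
    calc C * (2 * τ + s * s) = 6 * (C * τ) := by rw [hss]; ring
      _ = 3 * (C * Real.sqrt τ) * s := by rw [hsdef]; nth_rewrite 1 [hτsq]; ring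
      _ ≤ 3 * (ε / 8) * s := mul_le_mul_of_nonneg_right (by linarith) hs0.le
      _ = s * (3 * ε / 8) := by ring
  have hfin : μ.real T ≤ 3 * ε / 8 := le_of_mul_le_mul_left (hchain.trans hkey) hs0
  linarith

end Summit.CriticalPhenomena.PercolationContinuityZ3.Theorems

end
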